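import Summits.HodgeConjecture.HodgeConjecture.Theorems.Ring2HypothesesWeilComponentsCMRosati
import Summits.HodgeConjecture.HodgeConjecture.Theorems.Ring2HypothesesWeilTypeCMExact
import Literature.AlgebraicGeometry.Deligne1982.WeilTypeCMDiscriminantExists
import HarnessLib

/-!
# Ring 2 — hypotheses layer, part XXXI-B: node 31b `PolarizedWeilDiscriminantCMExistsR` HOLDS (Deligne 1982, Lemma 4.6
  / Sublemma 4.7 on the carriers, a Literature THEOREM); node 31 `PolarizedWeilDiscriminantCMExists` ⟸ 31a ALONE; node 31
  FACT-FREE on the invariant locus; the δ-exactness rows re-based on 31a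

HONEST FRAMING: research route conditional on HC_CM; not a corollary; Q11.4-sentence-2 already refuted in dim ≥ 3.

Cell `pub-hodge-ring2`, seat `pub-hodge-ring2-typer2`, gen 21. Bookkeeping only: no new hypothesis node, no new class
target; nothing here is a case of the Hodge conjecture and `HC_CM` (`Theses.RankFourFaces.CMAbelianHodge`) does not occur.

WHAT HAPPENED. Part XXXI (`Ring2HypothesesWeilComponentsCMRosati`) split the typed existence statement node 31
`PolarizedWeilDiscriminantCMExists` into 31a `RosatiKaehlerClassSupplyCM` (a Rosati-compatible rational algebraic class of
Kähler type exists on every Weil-type CM datum — Deligne's ASSUMED sentence, Thm. 4.8 (a), p. 47) and 31b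
`PolarizedWeilDiscriminantCMExistsR` (for EVERY such class the `E`-Hermitian witness `(x_b, ω, c, Φ, q)` of
`Deligne1982.HasWeilDiscriminantCM` exists — §4 p. 30 (1), Lemma 4.6, Sublemma 4.7), with the seam 31a → 31b → 31. The
Literature seat then PROVED 31b's body on the carriers: `Deligne1982.exists_hasWeilDiscriminantCM` (file
`Literature/AlgebraicGeometry/Deligne1982/WeilTypeCMDiscriminantExists.lean`; trace-form Gram matrix over `E = ℚ[T]/(R(T²))`,
`q = t^{2k} · det Φ ∈ F_ℝˣ`, non-degeneracy from Hodge–Riemann in degree one for the Kähler multiple `s • h`; no named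
fact). COUNT ONCE: that theorem is the Literature seat's; this file only USES it (as node 36's discharge, part XXIX, used
`VanGeemen1994.exists_projectiveEmbedding_hasWeilDiscriminantNondeg`).

CONTENTS (namespace `Ring2.Hypotheses`):
* §1 `polarizedWeilDiscriminantCMExistsR_holds : PolarizedWeilDiscriminantCMExistsR` — node 31b DISCHARGED (one term).
* §2 `polarizedWeilDiscriminantCMExists_of_supply : RosatiKaehlerClassSupplyCM → PolarizedWeilDiscriminantCMExists` —
  node 31 now costs 31a ALONE (the classical Albert–Shimura / Deligne (a) supply of an `η`-adapted polarization, OPEN as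
  typed in the tree in general); `node31_ledger` records both.
* §3 `polarizedWeilDiscriminantCM_of_invariant` — node 31's conclusion with NO hypothesis node for every Weil-type CM datum
  on the invariant locus of part XXXI §4 (an automorphism `u`, inverse `v`, `v + η = u`, and a `u`-invariant rational
  algebraic Kähler-type class `h`): `∃ δ, IsPolarizationClass h ∧ RosatiCompatible A η h ∧ HasWeilDiscriminantCM A η R e₀ k h δ`.
  (As in XXXI, no datum on that locus is exhibited here — referee F69: the cyclotomic orbit-sum class is not yet typed.)
* §4 the δ-EXACTNESS rows of parts VII-D / XV re-based on 31a: `weilClassesWeilTypeCM_iff_byComponentCM_of_supply`,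
  `weilClassesCMField_iff_byComponentCM_of_supply`, `HC_CM_iff_weilRungs_of_andre_of_componentsCM_of_supply` — every other
  consumer of `(hE : PolarizedWeilDiscriminantCMExists)` is served by `polarizedWeilDiscriminantCMExists_of_supply h31a`
  in place of `hE` (primed rows are not multiplied here; append-only, the originals stay).

Sources: [cite: Deligne1982HodgeCycles, §4 p. 30 (1), Lemma 4.6, Sublemma 4.7, Thm. 4.8 (a)] (P. Deligne, Hodge cycles on
abelian varieties, in LNM 900, Springer 1982 — pp. 46–48 of the volume); [cite: vanGeemen1994HodgeAV, 5.2] (the quadratic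
case); [cite: MoonenZarhin1998WeilClasses, §1] (the exactness rows' criterion, a tree theorem).
-/

noncomputable section

set_option linter.dupNamespace false

open CategoryTheory
open Literature.AlgebraicGeometry Literature.AlgebraicGeometry.Motives Literature.AlgebraicGeometry.HodgeTheory
open Literature.AlgebraicGeometry.Deligne1982
open Literature.AlgebraicTopology.SingularHomology
open Summit.HodgeConjecture.HodgeConjecture.WeilTypeLadder
open Summit.HodgeConjecture.HodgeConjecture.Theses
open Summit.HodgeConjecture.HodgeConjecture.Ring2Transport

namespace Summit.HodgeConjecture.HodgeConjecture.Ring2.Hypotheses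

/-! ## §1 Node 31b is a theorem -/

/-- **Node 31b `PolarizedWeilDiscriminantCMExistsR` HOLDS**: for every Weil-type CM datum `(A, η; R, e₀, k)` and every
rational class `h` of Kähler type with `Q_h(η^*x, y) = -Q_h(x, η^*y)` there is `δ ∈ F_ℝˣ/N` with
`HasWeilDiscriminantCM A η R e₀ k h δ` — Deligne's Lemma 4.6 / Sublemma 4.7 and (1), proved on the carriers by the
Literature layer (`Deligne1982.exists_hasWeilDiscriminantCM`; `IsKaehlerMultiple` / `RosatiCompatible` unfold to its
hypotheses). [cite: Deligne1982HodgeCycles, §4 p. 30 (1), Lemma 4.6 and Sublemma 4.7] -/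
theorem polarizedWeilDiscriminantCMExistsR_holds : PolarizedWeilDiscriminantCMExistsR :=
  fun _R _ _A _η _e₀ _k _h hW hQ hK hros ↦ exists_hasWeilDiscriminantCM hW hQ hK hros

/-! ## §2 Node 31 costs 31a alone -/

/-- **Node 31 ⟸ node 31a**: granted the supply of a Rosati-compatible rational algebraic Kähler-type class on every
Weil-type CM datum (Deligne's assumption (a); Albert–Shimura), the typed existence statement
`PolarizedWeilDiscriminantCMExists` holds — its other half is the theorem of §1.
[cite: Deligne1982HodgeCycles, §4 Thm. 4.8 (a), Lemma 4.6] -/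
theorem polarizedWeilDiscriminantCMExists_of_supply (h31a : RosatiKaehlerClassSupplyCM) :
    PolarizedWeilDiscriminantCMExists :=
  polarizedWeilDiscriminantCMExists_of_supply_of_existsR h31a polarizedWeilDiscriminantCMExistsR_holds

/-- **NODE-31 LEDGER (audit)**: 31b holds outright and 31 follows from 31a alone.
[cite: Deligne1982HodgeCycles, §4 p. 30 (1), Lemma 4.6, Thm. 4.8 (a)] -/
theorem node31_ledger :
    PolarizedWeilDiscriminantCMExistsR ∧ (RosatiKaehlerClassSupplyCM → PolarizedWeilDiscriminantCMExists) :=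
  ⟨polarizedWeilDiscriminantCMExistsR_holds, polarizedWeilDiscriminantCMExists_of_supply⟩

/-! ## §3 Node 31 fact-free on the invariant locus -/

section Invariant

variable {A : AbelianVariety ℂ}

/-- **Node 31's conclusion with NO hypothesis node on the invariant locus**: a Weil-type CM datum `(A, η; R, e₀, k)` with
an automorphism `u` (inverse `v`), `v + η = u`, and a `u`-invariant rational algebraic class `h` of Kähler type carries,
for that very `h`, a polarization class (hard Lefschetz included), the Rosati clause, and Deligne's discriminant witness
of some class `δ`. (Part XXXI §4 for the first two; §1 for the witness. No datum on the locus is exhibited here.)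
[cite: Deligne1982HodgeCycles, §4 p. 30 (1), Lemma 4.6, Thm. 4.8 (a) and §5 (5.2)] -/
theorem polarizedWeilDiscriminantCM_of_invariant {R : Polynomial ℤ} [Fact (Irreducible (realPolyQ R))] {e₀ k : ℕ}
    {η u v : A ⟶ A} (hW : IsWeilTypeCM A η R e₀ k) (huv : u ≫ v = 𝟙 A) (hvu : v ≫ u = 𝟙 A) (hη : v + η = u)
    {h : complexBetti A.X 2} (hQ : IsRationalClass h) (halg : h ∈ algebraicClasses A.X 1)
    (hK : IsKaehlerMultiple A h) (hinv : complexBetti.map u.hom.hom.hom 2 h = h) :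
    ∃ δ : cmNormResidueGroup R, IsPolarizationClass A.dim A.X h ∧ RosatiCompatible A η h ∧
      HasWeilDiscriminantCM A η R e₀ k h δ :=
  polarizedWeilDiscriminantCM_of_existsR_of_invariant polarizedWeilDiscriminantCMExistsR_holds hW huv hvu hη hQ halg
    hK hinv

end Invariant

/-! ## §4 The δ-exactness rows re-based on node 31a -/

/-- **W3-CM exactness on Deligne's carriers, granted 31a only**: rung R3⁺ `WeilClassesWeilTypeCM` ⟺ the conjunction of
the CM-field δ-component targets (part VII-D `weilClassesWeilTypeCM_iff_byComponentCM` with its node-31 binder served by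
§2). [cite: Deligne1982HodgeCycles, §4 p. 30 (1), Lemma 4.6 and Thm. 4.8 (a)] -/
theorem weilClassesWeilTypeCM_iff_byComponentCM_of_supply (h31a : RosatiKaehlerClassSupplyCM) :
    WeilClassesWeilTypeCM ↔ WeilClassesByComponentCM :=
  weilClassesWeilTypeCM_iff_byComponentCM (polarizedWeilDiscriminantCMExists_of_supply h31a)

/-- **W3-CM exactness against the LADDER rung, granted 31a only**: R3 `WeilClassesCMField` ⟺ the conjunction of the
CM-field δ-component targets (part XV `weilClassesCMField_iff_byComponentCM`, node-31 binder served by §2).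
[cite: Deligne1982HodgeCycles, §4 p. 30 (1) and Lemma 4.6] [cite: MoonenZarhin1998WeilClasses, §1] -/
theorem weilClassesCMField_iff_byComponentCM_of_supply (h31a : RosatiKaehlerClassSupplyCM) :
    WeilClassesCMField ↔ WeilClassesByComponentCM :=
  weilClassesCMField_iff_byComponentCM (polarizedWeilDiscriminantCMExists_of_supply h31a)

/-- **`HC_CM` ⟺ the two Weil rungs from the δ-refined CM-field leaves, granted André's theorem and 31a only** (part XV
`HC_CM_iff_weilRungs_of_andre_of_componentsCM`, node-31 binder served by §2; `HC_CM` occurs on both sides as the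
STATEMENT being priced, never as a hypothesis of a class target). [cite: Andre1992HodgeCM, Thm. 0.6.2]
[cite: Deligne1982HodgeCycles, §4 proof of Thm. 4.8, p. 30 (1) and §5] -/
theorem HC_CM_iff_weilRungs_of_andre_of_componentsCM_of_supply
    (hA : Andre1992_hodgeClasses_cmAbelianVariety_mem_span_pullback_weilClasses)
    (hP₂ : CMPointedWeilFamiliesQuadratic) (hV₂ : WeilVariationalHodgeQuadratic)
    (h31a : RosatiKaehlerClassSupplyCM)
    (hP : ∀ (R : Polynomial ℤ) [Fact (Irreducible (realPolyQ R))] (e₀ k : ℕ) (δ : cmNormResidueGroup R), 2 ≤ e₀ →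
      CMPointedWeilFamiliesComponentCM R e₀ k δ)
    (hV : ∀ (R : Polynomial ℤ) [Fact (Irreducible (realPolyQ R))] (e₀ k : ℕ) (δ : cmNormResidueGroup R), 2 ≤ e₀ →
      WeilVariationalHodgeComponentCM R e₀ k δ) :
    Theses.RankFourFaces.CMAbelianHodge ↔ WeilClassesImaginaryQuadratic ∧ WeilClassesCMField :=
  HC_CM_iff_weilRungs_of_andre_of_componentsCM hA hP₂ hV₂ (polarizedWeilDiscriminantCMExists_of_supply h31a) hP hV

end Summit.HodgeConjecture.HodgeConjecture.Ring2.Hypotheses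

end
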